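import Summits.CriticalPhenomena.PercolationContinuityZ3.Theorems.Transplant.SkelConcExcessIn
import Summits.CriticalPhenomena.PercolationContinuityZ3.Theorems.Transplant.SkelConcReachHab
import Summits.CriticalPhenomena.PercolationContinuityZ3.Theorems.Transplant.SkelConcHout
import Summits.CriticalPhenomena.PercolationContinuityZ3.Theorems.Transplant.BoxProdZ2ConcReachExcess
import HarnessLib

/-!
# The rim excess of the corridor test over a planar skeleton, in the corridor-world window graph

builds on p205010 (kernel theorem, internal audit signed; external expert review pending).

Generic ((C), general node) twin of `BoxProdZ2.real_rim_le_concG` (`BoxProdZ2ConcReachExcess`): for the concentric scheme of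
record `⟨Skel.cellGeomSG Φ C t Λ, q, δc⟩` over a `PlanarSkeletonConc Φ` rooted at `t`, the probability under the corridor law
`Wcor` that the root is joined to a RIM set — a part of the fresh habitat `Skel.habΩ = E^{α}_{x,y} ∪ H^{a'}_{y,y+du}` lying inside
the habitat proper `Q_α(y) ∪ E^far` and beyond depth `E − L'` — is at most the uniform excess bound `η` of an excess radius
`R₁ ≤ E − L'`, provided the explored neighbours of the fresh habitat are deep (`hdeep`, supplied on runs by `Skel.deep_of_run`).

Design (the Ω-route, lane ruling 2026-08-20): the exploration graph for the excess is the window graph `winGraphIn G Ucor` of the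
WHOLE corridor world `Ucor = Vx ∪ E_{x,y} ∪ H` (so explored vertices are graph vertices and the subbox side-condition needs no
separation), the region is the fresh habitat minus the explored vertices, and the excess lemma is `Skel.real_rim_le_of_radius_In`
(`SkelConcExcessIn`). [cite: KozmaNitzan2024, §4 Lemma 12 (pp. 23–25), p. 30 (Step IV), p. 31]
-/

open MeasureTheory

namespace Summit.CriticalPhenomena.PercolationContinuityZ3.Theorems

namespace Transplant

namespace Skel

open Literature.Probability.Percolation Literature.Probability.LatticeModels SimpleGraph GadgetSystem ProbeHistory HSiteScheme Contour KNCells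
open KNLevels
open Literature.Probability.Percolation.GM
open Literature.Probability.Percolation.KozmaNitzan.Cells (sgOf stepVec_apply_fst stepVec_apply_oth)
open Literature.Barriers.CriticalPhenomena (graphBall graphBall_finite mem_graphBall_self graphBall_mono)
open BoxProdZ2 (ConcRadiiG)

open scoped Classical

variable {V : Type} [DecidableEq V] {G : SimpleGraph V} [G.LocallyFinite] (Φ : PlanarSkeletonConc G)
variable {C : PCells} {t : V} {Λ : ConcRadiiG}

/-- **Rim excess of the corridor test, generic node.** Under the corridor law `Wcor` of the concentric scheme of record over a
planar skeleton (root `t`, cube span of depth `rQ = E`, incoming between-box of depth `≤ E`, staircase profile `≤ E`), if every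
explored neighbour of the fresh habitat `E_{x,y} ∪ H` has depth `≤ R₀` (`hdeep`) and `R₁ ≤ E − L'` is a uniform excess radius for
entrance depth `R₀ + 1` and planar spread `50 r` (`hR₁`), then the root is joined to a rim set `Rim` (fresh-habitat vertices of the
habitat proper beyond depth `E − L'`) with probability `≤ η`. [cite: KozmaNitzan2024, §4 Lemma 12 (pp. 23–25), p. 31] -/
theorem real_rim_le_concSG [Countable V] (hΛ : WFS C Λ) {q : unitInterval} {δc : ℝ} {h : ProbeHistory V} {e : Site 2 × MDir}
    (hV : (⟨cellGeomSG Φ C t Λ, q, δc⟩ : KSchA V ℕ).Valid₂ G h e) {a' : ℕ}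
    (ha' : a' ∈ (⟨cellGeomSG Φ C t Λ, q, δc⟩ : KSchA V ℕ).Γ.anchSet ((⟨cellGeomSG Φ C t Λ, q, δc⟩ : KSchA V ℕ).aOf₁ G h e) (tgt e))
    {du : MDir} (hdu : du ∈ (⟨cellGeomSG Φ C t Λ, q, δc⟩ : KSchA V ℕ).onward G h (tgt e))
    {E : ℕ} (hEQ : Λ.rQ ((⟨cellGeomSG Φ C t Λ, q, δc⟩ : KSchA V ℕ).aOf₁ G h e) (tgt e) = E)
    (hB : Λ.rB ((⟨cellGeomSG Φ C t Λ, q, δc⟩ : KSchA V ℕ).aOf₁ G h e) e.1 e.2 ≤ E) (hρ : ∀ ℓ, Λ.ρ a' (tgt e) du ℓ ≤ E)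
    {R₀ : ℕ}
    (hdeep : ∀ a ∈ (⟨cellGeomSG Φ C t Λ, q, δc⟩ : KSchA V ℕ).Vx G h,
      ∀ b ∈ (⟨cellGeomSG Φ C t Λ, q, δc⟩ : KSchA V ℕ).Γ.Ewv ((⟨cellGeomSG Φ C t Λ, q, δc⟩ : KSchA V ℕ).aOf₁ G h e) e.1 e.2 ∪
        (faceDataSG Φ C t Λ).Hfull a' (tgt e) du,
      b ∉ (⟨cellGeomSG Φ C t Λ, q, δc⟩ : KSchA V ℕ).Vx G h → G.Adj a b → a ∈ graphBall G t R₀)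
    {L' : ℕ} {η : ℝ} {R₁ : ℕ}
    (hR₁ : ∀ R', R₁ ≤ R' → ∀ (Rw : ℕ) (D' A' : Finset V), (∀ d ∈ D', d ∈ graphBall G t Rw) →
      (∀ d ∈ D', ∀ d' ∈ D', Φ.φ d - Φ.φ d' ∈ box 2 (50 * C.r)) → A' ⊆ D' → (∀ a ∈ A', a ∈ graphBall G t (R₀ + 1)) →
        (bondPercolation G q).real (excess G t R' D' A') ≤ η)
    (hR : R₁ ≤ E - L') {Rim : Finset V} (hRim : Rim ⊆ habΩ Φ C t (Λ := Λ) q δc h e a' du)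
    (hRimHab : Rim ⊆ (⟨cellGeomSG Φ C t Λ, q, δc⟩ : KSchA V ℕ).Γ.Q ((⟨cellGeomSG Φ C t Λ, q, δc⟩ : KSchA V ℕ).aOf₁ G h e) (tgt e) ∪
      (⟨cellGeomSG Φ C t Λ, q, δc⟩ : KSchA V ℕ).Γ.Efar a' (tgt e) du)
    (hRimfar : ∀ t' ∈ Rim, t' ∉ graphBall G t (E - L')) :
    (prodBernoulli ((⟨cellGeomSG Φ C t Λ, q, δc⟩ : KSchA V ℕ).Wcor G (faceDataSG Φ C t Λ) h e
      ((⟨cellGeomSG Φ C t Λ, q, δc⟩ : KSchA V ℕ).aOf₁ G h e) a' du)).real (⋃ t' ∈ Rim, openConn t t') ≤ η := by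
  set S : KSchA V ℕ := ⟨cellGeomSG Φ C t Λ, q, δc⟩ with hS
  set FD := faceDataSG Φ C t Λ with hFD
  set α := S.aOf₁ G h e with hα
  have hL := levelGeomSG Φ C t hΛ (Λ := Λ)
  have hQ : QSepGeom G S.Γ := qSepGeomSG Φ C t (Λ := Λ)
  have hSt := stepsGeomSG Φ C t hΛ (Λ := Λ)
  -- the fresh world `Wld = E_{x,y} ∪ H` and its unexplored part `D`
  set Wld : Finset V := S.Γ.Ewv α e.1 e.2 ∪ FD.Hfull a' (tgt e) du with hWld
  have hWldΩ : habΩ Φ C t (Λ := Λ) q δc h e a' du = Wld := rfl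
  set D : Finset V := Wld.filter (fun b => b ∉ S.Vx G h) with hDdef
  -- (f1) the world lies in the graph ball of radius `E`
  have hWπ : ∀ b ∈ Wld, b ∈ graphBall G t E := fun b hb =>
    mem_graphBall_of_mem_Ewv_Hfull Φ hB (le_of_eq hEQ) hρ hb
  -- (f2) planar footprints of the world lie in `cen y + Λ_{25 r}`
  have hWpl : ∀ b ∈ Wld, Φ.φ b ∈ (box 2 (25 * C.r)).image (fun s => s + C.cen (tgt e)) := by
    intro b hb
    rcases Finset.mem_union.1 hb with hb | hb
    · rw [CellGeom.Ewv] at hb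
      rcases Finset.mem_union.1 hb with hb | hb
      · change b ∈ Φ.VWin t (C.BtwN e.1 e.2) (Λ.rB α e.1 e.2) at hb
        exact C.BtwN_subset_box_image_tgt e.1 e.2 (Φ.φ_mem_of_mem_VWin hb)
      · change b ∈ Φ.VWin t (C.Q (tgt e)) (Λ.rQ α (tgt e)) at hb
        exact C.Q_subset_box_image _ (Φ.φ_mem_of_mem_VWin hb)
    · change b ∈ Φ.VStair t (C.Hfull (tgt e) du) (prof C Λ a' (tgt e) du) at hb
      exact C.Hfull_subset_box_image _ _ (Φ.mem_of_mem_VStair hb).1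
  -- (f3) `Wld ⊆ Sx` and (f4) `Wld ⊆ Ucor`
  have hWSx : Wld ⊆ S.Sx G h e α a' du := by
    intro v hv
    rcases Finset.mem_union.1 hv with hv | hv
    · exact Finset.mem_union_left _ (Finset.mem_union_right _ hv)
    · rcases Finset.mem_union.1 (hSt.Hfull_subset _ _ _ _ ha' hv) with hv' | hv'
      · exact Finset.mem_union_left _ (Finset.mem_union_right _ (Finset.mem_union_right _ hv'))
      · exact Finset.mem_union_right _ hv'
  have hWU : Wld ⊆ S.Ucor G FD h e α a' du := by
    intro v hv
    rcases Finset.mem_union.1 hv with hv | hv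
    · exact Finset.mem_union_left _ (Finset.mem_union_right _ hv)
    · exact Finset.mem_union_right _ hv
  have hDW : D ⊆ Wld := Finset.filter_subset _ _
  have hDV : ∀ b ∈ D, b ∉ S.Vx G h := fun b hb => (Finset.mem_filter.1 hb).2
  -- vertices of `Ucor` outside `D` are explored
  have hUout : ∀ x ∈ S.Ucor G FD h e α a' du, x ∉ D → x ∈ S.Vx G h := by
    intro x hx hxD
    by_contra hxV
    rcases Finset.mem_union.1 hx with hx | hx
    · rcases Finset.mem_union.1 hx with hx | hx
      · exact hxV hx
      · exact hxD (Finset.mem_filter.2 ⟨Finset.mem_union_left _ hx, hxV⟩)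
    · exact hxD (Finset.mem_filter.2 ⟨Finset.mem_union_right _ hx, hxV⟩)
  -- the subbox property of `Wcor` on `D` in the window graph of the corridor world (no separation needed: `Ucor` IS the graph)
  have hWD : IsSubbox (winGraphIn G (S.Ucor G FD h e α a' du)) (S.Wcor G FD h e α a' du) q D :=
    KSchA.isSubbox_Wcor_graph (winGraphIn G (S.Ucor G FD h e α a' du)) (winGraphIn_le G _) hV.F_eq
      (hDW.trans hWSx) (hDW.trans hWU) (Finset.disjoint_left.2 fun b hb hbV => hDV b hb hbV)
      (fun u hu v hv huv => (winGraphIn_adj G).2 ⟨huv, hWU (hDW hu), hWU (hDW hv)⟩)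
      (fun v hv x hx _ hadj => (winGraphIn_adj G).2 ⟨hadj, hx, hWU (hDW hv)⟩)
  -- `Wcor` vanishes off the edges of `G`
  have hWG : ∀ x, x ∉ G.edgeSet → S.Wcor G FD h e α a' du x = 0 := by
    intro x hx
    by_cases hxU : x ∈ wireSet (↑(S.Ucor G FD h e α a' du) : Set V)
    · by_cases hxS : x ∈ wireSet (↑(S.Sx G h e α a' du) : Set V)
      · have hxF : x ∉ S.F G h := by
          intro hxF
          rw [hV.F_eq, mem_edgesIn_iff] at hxF
          exact hx hxF.1
        rw [KSchA.Wcor_apply_of_mem hxU hxS hxF, KNLevels.lattW_apply, if_neg hx]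
      · show restrW _ (restrW _ _) x = 0
        rw [restrW_apply_of_mem _ hxU, restrW_apply_of_not_mem _ hxS]
    · exact restrW_apply_of_not_mem _ hxU
  -- the root is explored, hence outside `D`
  have hroot : t ∉ D := fun hr => hDV _ hr (by have := hV.root_mem; exact this)
  -- the rim lies in `D`: inside the world (hypothesis) and fresh (separation of the habitat from the explored region)
  have hRimD : Rim ⊆ D := by
    intro t' ht
    refine Finset.mem_filter.2 ⟨hWldΩ ▸ hRim ht, fun htV => ?_⟩
    exact Finset.disjoint_left.1 (KSchA.disjoint_Vx_of_fresh hL hQ hV hdu hRimHab) ht htV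
  -- entrances are deep
  have hA : ∀ a b, a ∉ D → b ∈ D → G.Adj a b → S.Wcor G FD h e α a' du s(a, b) ≠ 0 → b ∈ graphBall G t (R₀ + 1) := by
    intro a b haD hbD hadj hW
    have haU : a ∈ S.Ucor G FD h e α a' du := by
      by_contra haU
      exact hW (restrW_apply_of_not_mem _ fun hw => haU (Finset.mem_coe.1 (mk_mem_wireSet_iff.1 hw).1))
    have haV : a ∈ S.Vx G h := hUout a haU haD
    exact BoxProdZ2.mem_graphBall_succ_of_adj G (hdeep a haV b (hDW hbD) (hDV b hbD) hadj) hadj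
  -- planar spread of `D`: differences of footprints lie in `Λ_{50 r}`
  have hDm : ∀ d ∈ D, ∀ d' ∈ D, Φ.φ d - Φ.φ d' ∈ box 2 (50 * C.r) := by
    intro d hd d' hd'
    obtain ⟨s, hs, hse⟩ := Finset.mem_image.1 (hWpl d (hDW hd))
    obtain ⟨s', hs', hse'⟩ := Finset.mem_image.1 (hWpl d' (hDW hd'))
    rw [← hse, ← hse', show s + C.cen (tgt e) - (s' + C.cen (tgt e)) = s - s' by abel]
    rw [mem_box] at hs hs' ⊢
    intro i
    have h1 := hs i
    have h2 := hs' i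
    simp only [Pi.sub_apply]
    push_cast
    omega
  -- (`Skel.real_rim_le_of_radius_In` is stated at the classical `DecidableEq`; the subbox structure transports along the subsingleton)
  exact real_rim_le_of_radius_In Φ (Wt := S.Wcor G FD h e α a' du) (q := q) (D := D) (by convert hWD) (hDW.trans hWU) hWG hroot
    hRimD hRimfar hA hR₁ hR (fun b hb => hWπ b (hDW hb)) hDm

end Skel

end Transplant

end Summit.CriticalPhenomena.PercolationContinuityZ3.Theorems
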